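import Summits.BirchSwinnertonDyer.BirchSwinnertonDyer.Theorems.RamifiedHeegnerPairLeafRankOneUpperAtThreeShimuraInertOfLowerRankZero
import HarnessLib
import Literature.NumberTheory.EllipticCurves.NonvanishingTwistsPrescribedInert

/-!
# Route `RamifiedHeegnerPair`, crux U₁ `LeafRankOneUpperAtThree` (stmt-BirchSwinnertonDyer-26022), line `splitkolyvagin` —
# the INERT-CARRIER (Shimura-curve) road, part 4: the odd-discriminant twist supply WITHOUT `2 ∣ N_E`

HONEST FRAMING. Theorems + ONE cited named fact stated inline for the gate to relocate (a special case of Friedberg–Hoffstein 1995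
Thm. B in the exact use of Jetchev–Skinner–Wan 2017 §7.4.2 (a)–(d): the tree's `friedbergHoffstein_exists_twist_ne_zero_inertAt`
omits their clause (c) «an auxiliary prime splits»; this file's fact keeps it, for an auxiliary integer `M`). Helper file
(`--supports stmt-BirchSwinnertonDyer-26022 --as helper`); nothing is booked, no item is closed, BSD is not proved for any curve;
CONDITIONAL on every displayed input. Lead prover bsd-line-rhp-p2 g10, 2026-08-28.

WHY. Part 2/3 (`…ShimuraInert.lean`, `…ShimuraInertOfLowerRankZero.lean`) obtain the ODD discriminant the leaf-stability lemma needs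
from `2 ∣ N_E` (the bad prime `2` is then inert or split). For a leaf curve GOOD at `2` (census: 23 of the 116 Shimura-shaped
multi-carrier rank-one classes) one asks the field to split `2` as well — JSW's own clause (c) with their auxiliary prime `p` read as
`2`. With that supply the `2 ∣ N_E` binder disappears:

* `leafRankOneUpper_three_of_shimuraInert_of_partnerLower_of_splitSupply`, `…_of_lowerRankZero_of_splitSupply` — parts 2 §2 / 3 §3
  without `2 ∣ N_E`, from the inline fact `friedbergHoffstein_exists_twist_ne_zero_inertAt_splitAt` with `M = 2`.

References: [cite: FriedbergHoffstein1995, Thm. B] [cite: JetchevSkinnerWan2017, §7.4.2 (p. 31) (a)–(d); §4.1 (H) and the sign (p. 17)]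
[cite: Serre1973, Ch. II §3.3 Thms 3–4] [cite: Miller2011LMS, Def. 1.1].
-/

-- D-0017: single-problem summit, so `Summit.BirchSwinnertonDyer.BirchSwinnertonDyer.…` repeats a namespace BY DESIGN.
set_option linter.dupNamespace false
set_option autoImplicit false

noncomputable section

open scoped Classical NumberField

open WeierstrassCurve NumberField IsDedekindDomain Literature Literature.NumberTheory.EllipticCurves
  Rat.HeightOneSpectrum
  Literature.NumberTheory.EllipticCurves.ModularForms
  Literature.NumberTheory.EllipticCurves.Rank1Residual
  Literature.NumberTheory.EllipticCurves.Rank1Residual.Typed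
  Literature.NumberTheory.QuadraticFields.Quadratic
  Literature.NumberTheory.Automorphic
  Summit.BirchSwinnertonDyer.Rank1Residual
  Summit.BirchSwinnertonDyer.Rank1Residual.Additive
  Summit.BirchSwinnertonDyer.Rank1Residual.X11b
  Summit.BirchSwinnertonDyer.Rank1Residual.X11b.Three
  Summit.BirchSwinnertonDyer.BirchSwinnertonDyer.Theses.RamifiedHeegnerPair
  Summit.BirchSwinnertonDyer.BirchSwinnertonDyer.Theorems

namespace Summit.BirchSwinnertonDyer.BirchSwinnertonDyer.Theorems.LeafShimuraInert

/-! ## §5 The named fact: Friedberg–Hoffstein with an even inert set, the conductor split, AND an auxiliary integer split -/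

/-- The inert-and-conductor-split form is the case of the fact with the auxiliary clause forgotten. [cite: FriedbergHoffstein1995, Thm. B]
[cite: JetchevSkinnerWan2017, §7.4.2 (p. 31)] -/
theorem friedbergHoffstein_exists_twist_ne_zero_inertAt_of_splitAt
    (h : Literature.NumberTheory.EllipticCurves.friedbergHoffstein_exists_twist_ne_zero_inertAt_splitAt) :
    friedbergHoffstein_exists_twist_ne_zero_inertAt := by
  intro W _ hw S hS hSe B
  obtain ⟨K, hKf, hKn, hK, hB, hin, hsp, -, hL⟩ := h W hw S hS hSe 1 one_ne_zero B
  exact ⟨K, hKf, hKn, hK, hB, hin, hsp, hL⟩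

/-! ## §6 The road without `2 ∣ N_E` -/

/-- **`d_K` is odd when `2` is inert-and-unramified or split in `K`.** [cite: Serre1973, Ch. II §3.3 Thms 3–4] -/
theorem odd_discr_of_two_inert_or_split {K : Type} [Field K] [NumberField K] (h2 : Module.finrank ℚ K = 2)
    (h : (((Ideal.span {(2 : ℤ)}).primesOver (𝓞 K)).ncard = 1 ∧ ¬ (2 : ℤ) ∣ NumberField.discr K) ∨
      ((Ideal.span {(2 : ℤ)}).primesOver (𝓞 K)).ncard = 2) :
    Odd (NumberField.discr K) := by
  rcases h with ⟨-, hd⟩ | hs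
  · exact Int.odd_iff.mpr (by omega)
  · have h8 := (ncard_primesOver_two_eq_two_iff h2).mp hs
    exact Int.odd_iff.mpr (by omega)

/-- **U₁ at a leaf curve on a «Shimura row», NO `2 ∣ N_E` binder, from published facts + the partner-lower supply.** Part 2 §2 with
the field supplied by `friedbergHoffstein_exists_twist_ne_zero_inertAt_splitAt` at `M = 2` (so `2` is inert-unramified or split, and
`d_K` is odd). CONDITIONAL; nothing booked. [cite: FriedbergHoffstein1995, Thm. B] [cite: JetchevSkinnerWan2017, §7.4.2 (p. 31), Thm. 4.4.1 (p. 19)]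
[cite: PastenShimura2024, Prop. 6.13, Lemmas 6.15–6.16, 6.18 (pp. 23–25)] -/
theorem leafRankOneUpper_three_of_shimuraInert_of_partnerLower_of_splitSupply
    -- published inputs (named facts of the tree)
    (hGZK : rank_eq_analyticRank_of_analyticRank_le_one) (hmod : hasEntireLFunction_rat)
    (hnf : exists_isNewformOf) (hJL : nonempty_shimuraParametrizationData)
    (hCO : PastenShimura2024_componentOrders)
    (hHK : shimuraCurve_heegnerPoint_grossZagier_kolyvagin)
    (hFH2 : Literature.NumberTheory.EllipticCurves.friedbergHoffstein_exists_twist_ne_zero_inertAt_splitAt)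
    -- the leaf curve, with a datum whose constant is a `3`-unit
    (W : WeierstrassCurve ℚ) [W.IsElliptic] [W.IsGloballyMinimal]
    (hadd : Addv W 3) (hsub : SubGss W 3) (hr : W.analyticRank = 1)
    {N : ℕ} [NeZero N] (hN : W.conductorNorm ℤ = N)
    (Dt : ModularParametrizationData W N) (hc : ¬ (3 : ℤ) ∣ Dt.c)
    -- the inert set, SHAPE and (DEG)-availability, as in part 2 §1
    (S : Finset ℕ) (hSeven : Even S.card)
    (hSmult : ∀ ℓ ∈ S, ∃ _ : Fact ℓ.Prime, W.HasMultiplicativeReductionAtPrime ℓ)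
    (hFC : ∀ (ℓ : ℕ) [Fact ℓ.Prime], ℓ ∉ S → W.HasSplitMultiplicativeReductionAtPrime ℓ →
      ¬ 3 ∣ padicValInt ℓ W.minimalDiscriminantInt)
    (hshape : ∀ (q : ℕ) [Fact q.Prime], 3 ∣ (W.baseChange ℚ_[q]).localTamagawaNumber ℤ_[q] →
      W.HasSplitMultiplicativeReductionAtPrime q)
    (hDEG : (∃ ℓ₀ ∈ S, ¬ 3 ∣ padicValInt ℓ₀ W.minimalDiscriminantInt) ∨
      (∃ ℓ₀ t : ℕ, ∃ _ : Fact ℓ₀.Prime, ∃ _ : Fact t.Prime,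
        W.HasMultiplicativeReductionAtPrime ℓ₀ ∧ W.HasMultiplicativeReductionAtPrime t ∧
        ℓ₀ ∉ S ∧ t ∉ S ∧ t ≠ ℓ₀ ∧ ¬ 3 ∣ padicValInt ℓ₀ W.minimalDiscriminantInt) ∨
      (∃ q₁ q₂ : ℕ, S = {q₁, q₂} ∧ q₁ ≠ q₂ ∧ q₂ ≠ 2 ∧ q₂ % 3 ≠ 1))
    -- the partner-lower supply: every odd imaginary quadratic field with `3` split and `L(E^{d},1) ≠ 0`
    (hPL : ∀ (K : Type) [Field K] [NumberField K], IsImaginaryQuadratic K → Odd (NumberField.discr K) →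
      SatisfiesHeegnerHypothesis 3 K → (W.quadraticTwist (NumberField.discr K : ℚ)).entireLFunction 1 ≠ 0 →
      ∀ (Wd : WeierstrassCurve ℚ) [Wd.IsElliptic] [Wd.IsGloballyMinimal] (Cd : VariableChange ℚ),
        Cd • W.quadraticTwist (NumberField.discr K : ℚ) = Wd → Typed.MissingLowerBoundAt Wd 3) :
    Typed.MissingUpperBoundAt W 3 := by
  haveI h3F : Fact (Nat.Prime 3) := ⟨Nat.prime_three⟩
  have hp : (3 : ℕ).Prime := Nat.prime_three
  -- the sign of the functional equation is `−1` (modularity, `r_an = 1`)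
  have hw : W.rootNumber = -1 := by
    rw [WeierstrassCurve.rootNumber_eq_neg_one_pow_analyticRank_of_exists_isNewformOf hnf W, hr]
    norm_num
  -- the field of JSW §7.4.2 with `2` split unless inert
  obtain ⟨K, _, _, hK, -, hinert, hsplitN, hsplit2, hLt⟩ := hFH2 W hw S hSmult hSeven 2 two_ne_zero 4
  have hodd : Odd (NumberField.discr K) := by
    by_cases h2S : 2 ∈ S
    · obtain ⟨hn, hd⟩ := hinert 2 h2S
      exact odd_discr_of_two_inert_or_split hK.1
        (Or.inl ⟨by simpa only [Nat.cast_ofNat] using hn, by simpa only [Nat.cast_ofNat] using hd⟩)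
    · have hn := hsplit2 2 Nat.prime_two (dvd_refl 2) h2S
      exact odd_discr_of_two_inert_or_split hK.1 (Or.inr (by simpa only [Nat.cast_ofNat] using hn))
  -- `3` splits (it is a bad prime outside `S`)
  have hbad3 : ¬ W.HasGoodReductionAtPrime 3 := not_good_of_addv W 3 hadd
  have h3S : 3 ∉ S := by
    intro h
    obtain ⟨_, hm⟩ := hSmult 3 h
    exact not_mult_of_addv W 3 hadd hm
  have h3N : 3 ∣ W.conductorNorm ℤ := (W.dvd_conductorNorm_iff_not_hasGoodReductionAtPrime 3).mpr hbad3
  have hH3 : SatisfiesHeegnerHypothesis 3 K := fun q hq hq3 ↦ by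
    have : q = 3 := (Nat.prime_dvd_prime_iff_eq hq hp).mp hq3
    subst this; exact hsplitN 3 hp h3N h3S
  exact leafRankOneUpper_three_of_shimuraInertDatum hGZK hmod hnf hJL hCO hHK W hadd hsub hr hN Dt hc S hSeven hSmult
    hFC hshape hDEG K hK hodd hinert hsplitN hLt (fun Wd _ _ Cd hWd ↦ hPL K hK hodd hH3 hLt Wd Cd hWd)

/-- **U₁ AT A LEAF CURVE ON A «SHIMURA ROW», NO `2 ∣ N_E`, from published named facts and L₀ — no Σ-stub.** §6 with the partner-lower
supply paid by the route member L₀ `Gss2LowerAtThreeRankZero` (part 3 `partnerLowerSplitThree_of_lowerRankZero`). CONDITIONAL; nothing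
booked; U₁ / L₀ OPEN; BSD is not proved. [cite: FriedbergHoffstein1995, Thm. B] [cite: JetchevSkinnerWan2017, §7.4.2 (p. 31), Thm. 4.4.1 (p. 19)]
[cite: CaiShuTian2014, Thm. 1.5] [cite: PastenShimura2024, Prop. 6.13, Lemmas 6.15–6.16, 6.18 (pp. 23–25)] [cite: Miller2011LMS, Def. 1.1] -/
theorem leafRankOneUpper_three_of_shimuraInert_of_lowerRankZero_of_splitSupply
    -- published inputs (named facts of the tree)
    (hGZK : rank_eq_analyticRank_of_analyticRank_le_one) (hmod : hasEntireLFunction_rat)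
    (hnf : exists_isNewformOf) (hJL : nonempty_shimuraParametrizationData)
    (hCO : PastenShimura2024_componentOrders)
    (hHK : shimuraCurve_heegnerPoint_grossZagier_kolyvagin)
    (hFH2 : Literature.NumberTheory.EllipticCurves.friedbergHoffstein_exists_twist_ne_zero_inertAt_splitAt)
    -- the route member L₀ BY NAME
    (hL0 : Summit.BirchSwinnertonDyer.BirchSwinnertonDyer.Theses.RamifiedHeegnerPair.Gss2LowerAtThreeRankZero)
    -- the leaf curve, with a datum whose constant is a `3`-unit
    (W : WeierstrassCurve ℚ) [W.IsElliptic] [W.IsGloballyMinimal]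
    (hCM : ¬ W.HasCM) (hadd : Addv W 3) (hsub : SubGss W 3) (hr : W.analyticRank = 1)
    {N : ℕ} [NeZero N] (hN : W.conductorNorm ℤ = N)
    (Dt : ModularParametrizationData W N) (hc : ¬ (3 : ℤ) ∣ Dt.c)
    -- the inert set, SHAPE and (DEG)-availability
    (S : Finset ℕ) (hSeven : Even S.card)
    (hSmult : ∀ ℓ ∈ S, ∃ _ : Fact ℓ.Prime, W.HasMultiplicativeReductionAtPrime ℓ)
    (hFC : ∀ (ℓ : ℕ) [Fact ℓ.Prime], ℓ ∉ S → W.HasSplitMultiplicativeReductionAtPrime ℓ →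
      ¬ 3 ∣ padicValInt ℓ W.minimalDiscriminantInt)
    (hshape : ∀ (q : ℕ) [Fact q.Prime], 3 ∣ (W.baseChange ℚ_[q]).localTamagawaNumber ℤ_[q] →
      W.HasSplitMultiplicativeReductionAtPrime q)
    (hDEG : (∃ ℓ₀ ∈ S, ¬ 3 ∣ padicValInt ℓ₀ W.minimalDiscriminantInt) ∨
      (∃ ℓ₀ t : ℕ, ∃ _ : Fact ℓ₀.Prime, ∃ _ : Fact t.Prime,
        W.HasMultiplicativeReductionAtPrime ℓ₀ ∧ W.HasMultiplicativeReductionAtPrime t ∧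
        ℓ₀ ∉ S ∧ t ∉ S ∧ t ≠ ℓ₀ ∧ ¬ 3 ∣ padicValInt ℓ₀ W.minimalDiscriminantInt) ∨
      (∃ q₁ q₂ : ℕ, S = {q₁, q₂} ∧ q₁ ≠ q₂ ∧ q₂ ≠ 2 ∧ q₂ % 3 ≠ 1)) :
    Typed.MissingUpperBoundAt W 3 :=
  leafRankOneUpper_three_of_shimuraInert_of_partnerLower_of_splitSupply hGZK hmod hnf hJL hCO hHK hFH2 W hadd hsub hr hN Dt
    hc S hSeven hSmult hFC hshape hDEG
    (fun K _ _ hK hodd hH3 hLt Wd _ _ Cd hWd ↦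
      partnerLowerSplitThree_of_lowerRankZero hmod hL0 W hCM hadd hsub K hK hodd hH3 hLt Wd Cd hWd)

end Summit.BirchSwinnertonDyer.BirchSwinnertonDyer.Theorems.LeafShimuraInert

end
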